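import Mathlib.NumberTheory.Padics.RingHoms
import Mathlib.NumberTheory.Padics.ProperSpace
import Mathlib.Topology.Algebra.ClopenNhdofOne
import Mathlib.Topology.Algebra.OpenSubgroup
import Mathlib.Topology.Algebra.ContinuousMonoidHom
import Mathlib.Data.Nat.Factorization.Basic
import Mathlib.GroupTheory.OrderOfElement
import HarnessLib

/-!
# A continuous surjection of a profinite group onto `ℤ_p` SPLITS: the `p`-part `γ_p` of a lift `γ` of
# `1 ∈ ℤ_p` topologically generates a closed subgroup mapping isomorphically onto `ℤ_p` — PROVED

Topic `GroupTheory` (profinite groups); namespace `Literature.GroupTheory`. THEOREMS ONLY (no definition,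
no named fact, no instance, no `sorry`). Cell `bsd-stepL`, seat `bsd-stepL-imc-p1` (g11): module M2b of
the tree-mapped discharge plan `NOTE-prop323-Shapiro-discharge-plan-imc-p1-g11` (Shapiro's lemma for the
anticyclotomic Selmer group, [SkinnerUrban2014] Prop. 3.2.3): the continuous SECTION of a `ℤ_p`-quotient
`κ : G → ℤ_p` that `BigRepModule.exists_cocycle_apply_zero_eq` (M2a, surjectivity of Shapiro's map)
consumes. `ℤ_p`-analogue of the tree's `FreeProcyclicQuotientRetraction.lean` (free procyclic quotients).

## Statement and proof

**`exists_continuousMonoidHom_section_padicInt`**: for a compact totally disconnected topological group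
`G` (e.g. profinite), a continuous homomorphism `κ : G → ℤ_p` and `γ ∈ G` with
`κ γ = 1`, there is a continuous homomorphism `σ : ℤ_p → G` with `κ ∘ σ = id`.
Proof (the `p`-PART of `γ`): choose `u_k ∈ ℕ` with `u_k ≡ 1 (mod p^k)` and `u_k ≡ 0 (mod (k!)_{p'})`
(`(k!)_{p'} = k!/p^{v_p(k!)}`, Chinese remainder). For every open normal subgroup `U` of index `n` and all
`k, k' ≥ n`: `u_k ≡ u_{k'} (mod n)` and `n ∣ u_k p^k` (`modEq_expo`, `dvd_expo_mul_pow`), so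
`γ^{u_k} U` is eventually constant and `(γ^{u_k})^{p^k} ∈ U`. By compactness the nested closed sets
`cl{γ^{u_j} : j ≥ k}` have a common point `γ_p`; it lies in `γ^{u_k} U` for `k ≥ n(U)`, has
`κ γ_p = 1` (`u_k → 1` `p`-adically), and its image in every `G/U` has `p`-power order. Hence `κ` is
INJECTIVE on `C = cl⟨γ_p⟩` (an `x ∈ C ∩ ker κ` is approximated by `γ_p^t` with `p^k ∣ t`, so `x ∈ U` for
every `U`, so `x = 1`) and SURJECTIVE on `C` (compact image containing the dense `ℤ`); `C → ℤ_p` is a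
continuous bijection from a compact space to a Hausdorff one, i.e. a topological isomorphism, and
`σ = (C ↪ G) ∘ (κ|_C)⁻¹`.

HONEST FRAMING: classical profinite group theory (the `p`-Sylow subgroup of a procyclic group); nothing
about number fields. References: [SerreGaloisCohomology1997] I §1 (pro-`p` groups, Sylow subgroups of
profinite groups, §1.4) and I §2.5; [NeukirchSchmidtWingberg2008] (1.6.4); [RibesZalesskii2010] §2.3
(Sylow theory), Prop. 2.7.1 (procyclic groups).
-/

noncomputable section

open Multiplicative Topology Filter

namespace Literature.GroupTheory

/-! ## §1 The exponents `u_k`: `u_k ≡ 1 (p^k)`, `u_k ≡ 0 ((k!)_{p'})` -/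

section Exponents

variable (p : ℕ) [hp : Fact p.Prime]

/-- `p^k` and the prime-to-`p` part of `k!` are coprime. [cite: SerreGaloisCohomology1997, I §1.4 (Sylow)] -/
theorem coprime_pow_ordCompl_factorial (k : ℕ) :
    Nat.Coprime (p ^ k) (Nat.factorial k / p ^ (Nat.factorial k).factorization p) :=
  (Nat.coprime_ordCompl hp.out (Nat.factorial_ne_zero k)).pow_left k

/-- For `n ≠ 0` and `n ≤ k`: the `p`-part of `n` divides `p^k` and the prime-to-`p` part of `n`
divides the prime-to-`p` part of `k!`. [cite: SerreGaloisCohomology1997, I §1.4 (Sylow)] -/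
theorem ordProj_dvd_pow_and_ordCompl_dvd {n k : ℕ} (hn : n ≠ 0) (hnk : n ≤ k) :
    p ^ n.factorization p ∣ p ^ k ∧
      n / p ^ n.factorization p ∣ Nat.factorial k / p ^ (Nat.factorial k).factorization p := by
  refine ⟨pow_dvd_pow p ((Nat.factorization_lt p hn).le.trans hnk), ?_⟩
  have hm : n / p ^ n.factorization p ∣ Nat.factorial k :=
    (Nat.ordCompl_dvd n p).trans (Nat.dvd_factorial (Nat.pos_of_ne_zero hn) hnk)
  have hcop : Nat.Coprime (n / p ^ n.factorization p) (p ^ (Nat.factorial k).factorization p) :=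
    ((Nat.coprime_ordCompl hp.out hn).pow_left _).symm
  rw [← Nat.ordProj_mul_ordCompl_eq_self (Nat.factorial k) p] at hm
  exact hcop.dvd_of_dvd_mul_left hm

/-- **Coherence of the exponents**: if `u ≡ 1, u' ≡ 1 (mod p^k, p^{k'})` and `u ≡ 0, u' ≡ 0` modulo the
prime-to-`p` parts of `k!`, `k'!`, then `u ≡ u' (mod n)` for every `0 < n ≤ min k k'`.
[cite: SerreGaloisCohomology1997, I §1.4 (Sylow)] -/
theorem modEq_expo {n k k' u u' : ℕ} (hn : n ≠ 0) (hnk : n ≤ k) (hnk' : n ≤ k')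
    (hu1 : u ≡ 1 [MOD p ^ k]) (hu0 : u ≡ 0 [MOD Nat.factorial k / p ^ (Nat.factorial k).factorization p])
    (hu1' : u' ≡ 1 [MOD p ^ k'])
    (hu0' : u' ≡ 0 [MOD Nat.factorial k' / p ^ (Nat.factorial k').factorization p]) :
    u ≡ u' [MOD n] := by
  obtain ⟨hP, hm⟩ := ordProj_dvd_pow_and_ordCompl_dvd p hn hnk
  obtain ⟨hP', hm'⟩ := ordProj_dvd_pow_and_ordCompl_dvd p hn hnk'
  have h1 : u ≡ u' [MOD p ^ n.factorization p] := (hu1.of_dvd hP).trans (hu1'.of_dvd hP').symm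
  have h2 : u ≡ u' [MOD n / p ^ n.factorization p] := (hu0.of_dvd hm).trans (hu0'.of_dvd hm').symm
  have hcop : Nat.Coprime (p ^ n.factorization p) (n / p ^ n.factorization p) :=
    (Nat.coprime_ordCompl hp.out hn).pow_left _
  have := (Nat.modEq_and_modEq_iff_modEq_mul hcop).1 ⟨h1, h2⟩
  rwa [Nat.ordProj_mul_ordCompl_eq_self] at this

/-- `n ∣ u · p^k` when `u ≡ 0` modulo the prime-to-`p` part of `k!` and `0 < n ≤ k` (the image of
`γ^{u}` in a quotient of order `n` has `p`-power order). [cite: SerreGaloisCohomology1997, I §1.4 (Sylow)] -/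
theorem dvd_expo_mul_pow {n k u : ℕ} (hn : n ≠ 0) (hnk : n ≤ k)
    (hu0 : u ≡ 0 [MOD Nat.factorial k / p ^ (Nat.factorial k).factorization p]) : n ∣ u * p ^ k := by
  obtain ⟨hP, hm⟩ := ordProj_dvd_pow_and_ordCompl_dvd p hn hnk
  have hcop : Nat.Coprime (p ^ n.factorization p) (n / p ^ n.factorization p) :=
    (Nat.coprime_ordCompl hp.out hn).pow_left _
  have hmu : n / p ^ n.factorization p ∣ u := (Nat.modEq_zero_iff_dvd.1 (hu0.of_dvd hm))
  rw [← Nat.ordProj_mul_ordCompl_eq_self n p]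
  exact hcop.mul_dvd_of_dvd_of_dvd (hP.mul_left u |>.trans (by rw [mul_comm])) (hmu.mul_right _)

end Exponents

/-! ## §2 The `p`-part `γ_p` of a lift of `1`: existence, `κ γ_p = 1`, `p`-power order in every finite quotient -/

section PPart

variable {p : ℕ} [hp : Fact p.Prime] {G : Type*} [Group G] [TopologicalSpace G] [IsTopologicalGroup G]
  (κ : G →ₜ* Multiplicative ℤ_[p]) (γ : G) {u : ℕ → ℕ}

/-- Coherence in a finite quotient: for an open normal subgroup `U` of index `n` and `k, k' ≥ n`,
`γ^{u_k} ≡ γ^{u_{k'}} (mod U)`. [cite: SerreGaloisCohomology1997, I §1.4 (Sylow)] -/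
theorem mk_pow_expo_eq [CompactSpace G] (hu1 : ∀ k, u k ≡ 1 [MOD p ^ k])
    (hu0 : ∀ k, u k ≡ 0 [MOD Nat.factorial k / p ^ (Nat.factorial k).factorization p])
    (U : OpenNormalSubgroup G) {k k' : ℕ} (hk : Nat.card (G ⧸ U.toSubgroup) ≤ k)
    (hk' : Nat.card (G ⧸ U.toSubgroup) ≤ k') :
    (QuotientGroup.mk (γ ^ u k) : G ⧸ U.toSubgroup) = QuotientGroup.mk (γ ^ u k') := by
  have hn : Nat.card (G ⧸ U.toSubgroup) ≠ 0 := Nat.card_pos.ne'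
  rw [QuotientGroup.mk_pow, QuotientGroup.mk_pow]
  exact pow_eq_pow_iff_modEq.2
    ((modEq_expo p hn hk hk' (hu1 k) (hu0 k) (hu1 k') (hu0 k')).of_dvd (orderOf_dvd_natCard _))

/-- `p`-power order in a finite quotient: for `U` of index `n ≤ k`, `(γ^{u_k})^{p^k} ∈ U`.
[cite: SerreGaloisCohomology1997, I §1.4 (Sylow)] -/
theorem mk_pow_expo_pow_eq_one [CompactSpace G]
    (hu0 : ∀ k, u k ≡ 0 [MOD Nat.factorial k / p ^ (Nat.factorial k).factorization p])
    (U : OpenNormalSubgroup G) {k : ℕ} (hk : Nat.card (G ⧸ U.toSubgroup) ≤ k) :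
    ((QuotientGroup.mk (γ ^ u k) : G ⧸ U.toSubgroup)) ^ (p ^ k) = 1 := by
  have hn : Nat.card (G ⧸ U.toSubgroup) ≠ 0 := Nat.card_pos.ne'
  rw [QuotientGroup.mk_pow, ← pow_mul]
  exact orderOf_dvd_iff_pow_eq_one.1 ((orderOf_dvd_natCard _).trans (dvd_expo_mul_pow p hn hk (hu0 k)))

omit [IsTopologicalGroup G] in
/-- **Existence of the `p`-part**: the nested closed sets `cl{γ^{u_j} : j ≥ k}` of the compact `G` have
a common point. [cite: SerreGaloisCohomology1997, I §1.4 (Sylow subgroups of profinite groups)] -/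
theorem exists_mem_iInter_closure_pow_expo [CompactSpace G] (u : ℕ → ℕ) :
    ∃ γp : G, ∀ k : ℕ, γp ∈ closure ((fun j : ℕ ↦ γ ^ u j) '' Set.Ici k) := by
  obtain ⟨γp, hγp⟩ := IsCompact.nonempty_iInter_of_sequence_nonempty_isCompact_isClosed
    (fun k : ℕ ↦ closure ((fun j : ℕ ↦ γ ^ u j) '' Set.Ici k))
    (fun k ↦ closure_mono (Set.image_mono (Set.Ici_subset_Ici.2 (Nat.le_succ k))))
    (fun k ↦ ⟨γ ^ u k, subset_closure ⟨k, Set.mem_Ici.2 le_rfl, rfl⟩⟩)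
    (isClosed_closure.isCompact) (fun _ ↦ isClosed_closure)
  exact ⟨γp, fun k ↦ Set.mem_iInter.1 hγp k⟩

variable {κ γ}

/-- **`γ_p ≡ γ^{u_k} (mod U)` for `k ≥ n(U)`**: the coset `γ^{u_n} U` is closed and contains every later
`γ^{u_j}`, hence the limit point. [cite: SerreGaloisCohomology1997, I §1.4 (Sylow)] -/
theorem pow_expo_inv_mul_mem [CompactSpace G] (hu1 : ∀ k, u k ≡ 1 [MOD p ^ k])
    (hu0 : ∀ k, u k ≡ 0 [MOD Nat.factorial k / p ^ (Nat.factorial k).factorization p])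
    {γp : G} (hγp : ∀ k : ℕ, γp ∈ closure ((fun j : ℕ ↦ γ ^ u j) '' Set.Ici k))
    (U : OpenNormalSubgroup G) {k : ℕ} (hk : Nat.card (G ⧸ U.toSubgroup) ≤ k) :
    (γ ^ u k)⁻¹ * γp ∈ U := by
  set n := Nat.card (G ⧸ U.toSubgroup) with hn
  -- the closed set `{x | (γ^{u_n})⁻¹ x ∈ U}` contains `γ^{u_j}` for `j ≥ n`, hence `γp`
  have hS : IsClosed {x : G | (γ ^ u n)⁻¹ * x ∈ (U : Set G)} :=
    U.toOpenSubgroup.isClosed.preimage (continuous_const.mul continuous_id)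
  have hsub : (fun j : ℕ ↦ γ ^ u j) '' Set.Ici n ⊆ {x : G | (γ ^ u n)⁻¹ * x ∈ (U : Set G)} := by
    rintro _ ⟨j, hj, rfl⟩
    exact QuotientGroup.eq.1 (mk_pow_expo_eq γ hu1 hu0 U le_rfl (Set.mem_Ici.1 hj))
  have hγn : (γ ^ u n)⁻¹ * γp ∈ U := hS.closure_subset_iff.2 hsub (hγp n)
  have hkn : (γ ^ u k)⁻¹ * γ ^ u n ∈ U := QuotientGroup.eq.1 (mk_pow_expo_eq γ hu1 hu0 U hk le_rfl)
  have := U.toSubgroup.mul_mem hkn hγn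
  rwa [mul_assoc, mul_inv_cancel_left] at this

omit [IsTopologicalGroup G] in
/-- `κ(γ^m) = m` in `ℤ_p` for a lift `γ` of `1`. [cite: SerreGaloisCohomology1997, I §2.5] -/
theorem toAdd_kappa_pow (hγ : κ γ = ofAdd 1) (m : ℕ) : toAdd (κ (γ ^ m)) = (m : ℤ_[p]) := by
  rw [map_pow, hγ, ← ofAdd_nsmul, toAdd_ofAdd, nsmul_eq_mul, mul_one]

omit [IsTopologicalGroup G] in
/-- **`κ γ_p = 1`**: `κ(γ^{u_j}) = u_j → 1` `p`-adically (`u_j ≡ 1 (mod p^j)`).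
[cite: SerreGaloisCohomology1997, I §1.4 (Sylow)] -/
theorem kappa_pPart_eq (hγ : κ γ = ofAdd 1) (hu1 : ∀ k, u k ≡ 1 [MOD p ^ k])
    {γp : G} (hγp : ∀ k : ℕ, γp ∈ closure ((fun j : ℕ ↦ γ ^ u j) '' Set.Ici k)) :
    κ γp = ofAdd 1 := by
  -- `‖κ γp - 1‖ ≤ p^{-k}` for every `k`
  have hle : ∀ k : ℕ, ‖toAdd (κ γp) - 1‖ ≤ (p : ℝ) ^ (-(k : ℤ)) := by
    intro k
    have hT : IsClosed {y : G | ‖toAdd (κ y) - 1‖ ≤ (p : ℝ) ^ (-(k : ℤ))} :=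
      isClosed_le ((continuous_norm.comp ((continuous_toAdd.comp κ.continuous_toFun).sub
        continuous_const))) continuous_const
    refine hT.closure_subset_iff.2 ?_ (hγp k)
    rintro _ ⟨j, hj, rfl⟩
    have hkj : k ≤ j := Set.mem_Ici.1 hj
    have hdvd : (p ^ j : ℤ) ∣ (u j : ℤ) - 1 := by
      have := (hu1 j).symm.dvd
      push_cast at this
      exact this
    have h1 : ‖((((u j : ℤ) - 1 : ℤ)) : ℤ_[p])‖ ≤ (p : ℝ) ^ (-(j : ℤ)) :=
      PadicInt.norm_int_le_pow_iff_dvd.2 hdvd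
    have hp1 : (1 : ℝ) ≤ p := by exact_mod_cast hp.out.one_lt.le
    calc ‖toAdd (κ (γ ^ u j)) - 1‖ = ‖((((u j : ℤ) - 1 : ℤ)) : ℤ_[p])‖ := by
          rw [toAdd_kappa_pow hγ]; push_cast; rfl
      _ ≤ (p : ℝ) ^ (-(j : ℤ)) := h1
      _ ≤ (p : ℝ) ^ (-(k : ℤ)) := zpow_le_zpow_right₀ hp1 (by omega)
  -- hence `κ γp - 1 = 0`
  have h0 : ‖toAdd (κ γp) - 1‖ = 0 := by
    by_contra hne
    have hpos : 0 < ‖toAdd (κ γp) - 1‖ := lt_of_le_of_ne (norm_nonneg _) (Ne.symm hne)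
    have hp1 : (1 : ℝ) < p := by exact_mod_cast hp.out.one_lt
    obtain ⟨k, hk⟩ := exists_pow_lt_of_lt_one hpos (inv_lt_one_of_one_lt₀ hp1)
    have := hle k
    rw [zpow_neg, zpow_natCast, ← inv_pow] at this
    exact absurd (lt_of_le_of_lt this hk) (lt_irrefl _)
  rw [norm_eq_zero, sub_eq_zero] at h0
  rw [← ofAdd_toAdd (κ γp), h0]

end PPart

/-! ## §3 `κ` restricted to `C = cl⟨γ_p⟩` is bijective; the continuous section -/

section Section

variable {p : ℕ} [hp : Fact p.Prime] {G : Type*} [Group G] [TopologicalSpace G] [IsTopologicalGroup G]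
  [CompactSpace G] [TotallyDisconnectedSpace G]
  {κ : G →ₜ* Multiplicative ℤ_[p]} {γ : G} {u : ℕ → ℕ}

omit [IsTopologicalGroup G] [CompactSpace G] [TotallyDisconnectedSpace G] in
/-- `κ(γ_p^t) = t` for `t ∈ ℤ`. [cite: SerreGaloisCohomology1997, I §2.5] -/
theorem toAdd_kappa_zpow {γp : G} (hγp1 : κ γp = ofAdd 1) (t : ℤ) : toAdd (κ (γp ^ t)) = (t : ℤ_[p]) := by
  rw [map_zpow, hγp1, ← ofAdd_zsmul, toAdd_ofAdd, zsmul_eq_mul, mul_one]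

/-- **`κ` is injective on `cl⟨γ_p⟩`**: an element of `cl⟨γ_p⟩ ∩ ker κ` lies in every open normal
subgroup (it is approximated by `γ_p^t` with `p^k ∣ t`, and `γ_p` has `p`-power order mod `U`), hence
is `1`. [cite: SerreGaloisCohomology1997, I §1.4 (the `p`-Sylow subgroup of a procyclic group)] -/
theorem eq_one_of_mem_closure_zpowers_of_kappa_eq (hu1 : ∀ k, u k ≡ 1 [MOD p ^ k])
    (hu0 : ∀ k, u k ≡ 0 [MOD Nat.factorial k / p ^ (Nat.factorial k).factorization p])
    {γp : G} (hγp : ∀ k : ℕ, γp ∈ closure ((fun j : ℕ ↦ γ ^ u j) '' Set.Ici k))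
    (hγp1 : κ γp = ofAdd 1) {x : G} (hxC : x ∈ (Subgroup.zpowers γp).topologicalClosure)
    (hx : κ x = 1) : x = 1 := by
  -- it suffices that `x` lies in every open normal subgroup
  suffices hU : ∀ U : OpenNormalSubgroup G, x ∈ U.toSubgroup by
    by_contra hne
    obtain ⟨U, hUx⟩ := ProfiniteGrp.exist_openNormalSubgroup_sub_open_nhds_of_one
      (isOpen_compl_singleton (x := x)) (by simpa using (Ne.symm hne))
    exact hUx (hU U) rfl
  intro U
  set k := Nat.card (G ⧸ U.toSubgroup) with hk
  -- an open neighbourhood of `x`: same `U`-coset as `x`, and `κ` within `p^{-k}` of `κ x = 0`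
  have hball : IsOpen {y : G | ‖toAdd (κ y)‖ ≤ (p : ℝ) ^ (-(k : ℤ))} := by
    have : {y : G | ‖toAdd (κ y)‖ ≤ (p : ℝ) ^ (-(k : ℤ))} =
        (fun y ↦ toAdd (κ y)) ⁻¹' Metric.closedBall 0 ((p : ℝ) ^ (-(k : ℤ))) := by
      ext y; simp
    rw [this]
    exact (IsUltrametricDist.isOpen_closedBall _
      (zpow_ne_zero _ (Nat.cast_ne_zero.2 hp.out.ne_zero))).preimage
      (continuous_toAdd.comp κ.continuous_toFun)
  have hW : IsOpen ({y : G | x⁻¹ * y ∈ (U : Set G)} ∩ {y : G | ‖toAdd (κ y)‖ ≤ (p : ℝ) ^ (-(k : ℤ))}) :=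
    (U.toOpenSubgroup.isOpen.preimage (continuous_const.mul continuous_id)).inter hball
  have hxW : x ∈ {y : G | x⁻¹ * y ∈ (U : Set G)} ∩ {y : G | ‖toAdd (κ y)‖ ≤ (p : ℝ) ^ (-(k : ℤ))} := by
    refine ⟨?_, ?_⟩
    · rw [Set.mem_setOf_eq, inv_mul_cancel]
      exact U.toSubgroup.one_mem
    · rw [Set.mem_setOf_eq, hx, toAdd_one, norm_zero]
      exact zpow_nonneg (Nat.cast_nonneg p) _
  -- a power `γp ^ t` in that neighbourhood
  obtain ⟨y, ⟨hyU, hyk⟩, hyz⟩ := mem_closure_iff.1 hxC _ hW hxW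
  obtain ⟨t, rfl⟩ := Subgroup.mem_zpowers_iff.1 hyz
  -- `p^k ∣ t`, so `γp ^ t ∈ U`
  have hdvd : (p ^ k : ℤ) ∣ t := by
    rw [Set.mem_setOf_eq, toAdd_kappa_zpow hγp1] at hyk
    exact PadicInt.norm_int_le_pow_iff_dvd.1 hyk
  obtain ⟨t', rfl⟩ := hdvd
  have hγpk : (QuotientGroup.mk γp : G ⧸ U.toSubgroup) = QuotientGroup.mk (γ ^ u k) :=
    (QuotientGroup.eq.2 (pow_expo_inv_mul_mem hu1 hu0 hγp U le_rfl)).symm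
  have hmk : (QuotientGroup.mk (γp ^ ((p : ℤ) ^ k * t')) : G ⧸ U.toSubgroup) = 1 := by
    rw [QuotientGroup.mk_zpow, zpow_mul, show ((p : ℤ) ^ k : ℤ) = ((p ^ k : ℕ) : ℤ) by push_cast; rfl,
      zpow_natCast, hγpk, mk_pow_expo_pow_eq_one γ hu0 U le_rfl, one_zpow]
  have hmem : γp ^ ((p : ℤ) ^ k * t') ∈ U.toSubgroup := (QuotientGroup.eq_one_iff _).1 hmk
  -- `x = y · (x⁻¹ y)⁻¹ ∈ U`
  have := U.toSubgroup.mul_mem hmem (U.toSubgroup.inv_mem hyU)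
  rwa [mul_inv_rev, inv_inv, mul_inv_cancel_left] at this

omit [TotallyDisconnectedSpace G] in
/-- **`κ` maps `cl⟨γ_p⟩` ONTO `ℤ_p`**: the image is compact (closed) and contains the dense `ℤ`.
[cite: SerreGaloisCohomology1997, I §1.4 (Sylow)] -/
theorem exists_mem_closure_zpowers_kappa_eq {γp : G} (hγp1 : κ γp = ofAdd 1) (z : Multiplicative ℤ_[p]) :
    ∃ x ∈ (Subgroup.zpowers γp).topologicalClosure, κ x = z := by
  have hC : IsClosed (κ '' ((Subgroup.zpowers γp).topologicalClosure : Set G)) :=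
    ((Subgroup.isClosed_topologicalClosure _).isCompact.image κ.continuous_toFun).isClosed
  -- `ℤ` is dense in `ℤ_p`: the range of `t ↦ κ (γp ^ t) = t` is dense
  have hdense : DenseRange (fun t : ℤ ↦ κ (γp ^ t)) := by
    have heq : (fun t : ℤ ↦ κ (γp ^ t)) = ofAdd ∘ (Int.cast : ℤ → ℤ_[p]) := by
      funext t
      rw [Function.comp_apply, ← toAdd_kappa_zpow hγp1 t, ofAdd_toAdd]
    rw [heq]
    exact ofAdd.surjective.denseRange.comp PadicInt.denseRange_intCast continuous_ofAdd
  have hsub : Set.range (fun t : ℤ ↦ κ (γp ^ t)) ⊆ κ '' ((Subgroup.zpowers γp).topologicalClosure : Set G) := by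
    rintro _ ⟨t, rfl⟩
    exact ⟨γp ^ t, Subgroup.le_topologicalClosure _ (Subgroup.zpow_mem_zpowers γp t), rfl⟩
  have hz : z ∈ κ '' ((Subgroup.zpowers γp).topologicalClosure : Set G) :=
    hC.closure_subset_iff.2 hsub (hdense z)
  obtain ⟨x, hx, rfl⟩ := hz
  exact ⟨x, hx, rfl⟩

/-- **A continuous surjection of a profinite group onto `ℤ_p` SPLITS CONTINUOUSLY.** For a compact totally
disconnected topological group `G` (e.g. profinite), a continuous homomorphism `κ : G → ℤ_p` and `γ ∈ G` with
`κ γ = 1`, there is a continuous homomorphism `σ : ℤ_p → G` with `κ (σ y) = y` for all `y` (namely the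
inverse of `κ` on the closed procyclic pro-`p` subgroup `cl⟨γ_p⟩`, `γ_p` the `p`-part of `γ`).
[cite: SerreGaloisCohomology1997, I §1.4 (Sylow subgroups; `ℤ_p` is pro-`p` free on one generator) and I §2.5]
[cite: NeukirchSchmidtWingberg2008, (1.6.4)] -/
theorem exists_continuousMonoidHom_section_padicInt (κ : G →ₜ* Multiplicative ℤ_[p]) (γ : G)
    (hγ : κ γ = ofAdd 1) : ∃ σ : Multiplicative ℤ_[p] →ₜ* G, ∀ y, κ (σ y) = y := by
  classical
  -- the exponents and the `p`-part
  let u : ℕ → ℕ := fun k ↦ (Nat.chineseRemainder (coprime_pow_ordCompl_factorial p k) 1 0).1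
  have hu1 : ∀ k, u k ≡ 1 [MOD p ^ k] := fun k ↦
    (Nat.chineseRemainder (coprime_pow_ordCompl_factorial p k) 1 0).2.1
  have hu0 : ∀ k, u k ≡ 0 [MOD Nat.factorial k / p ^ (Nat.factorial k).factorization p] := fun k ↦
    (Nat.chineseRemainder (coprime_pow_ordCompl_factorial p k) 1 0).2.2
  obtain ⟨γp, hγp⟩ := exists_mem_iInter_closure_pow_expo γ u
  have hγp1 : κ γp = ofAdd 1 := kappa_pPart_eq hγ hu1 hγp
  -- `κ|_C : C → ℤ_p` is a continuous bijection from a compact group to a Hausdorff one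
  set C : Subgroup G := (Subgroup.zpowers γp).topologicalClosure with hCdef
  let κC : C →* Multiplicative ℤ_[p] := κ.toMonoidHom.comp C.subtype
  have hκC : Function.Bijective κC := by
    refine ⟨fun a b hab ↦ ?_, fun z ↦ ?_⟩
    · have h1 : κ ((a : G)⁻¹ * b) = 1 := by
        rw [map_mul, map_inv, inv_mul_eq_one]
        exact hab
      have hmem : ((a : G)⁻¹ * b) ∈ C := C.mul_mem (C.inv_mem a.2) b.2
      have := eq_one_of_mem_closure_zpowers_of_kappa_eq hu1 hu0 hγp hγp1 hmem h1
      exact Subtype.ext (inv_mul_eq_one.1 this)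
    · obtain ⟨x, hx, rfl⟩ := exists_mem_closure_zpowers_kappa_eq hγp1 z
      exact ⟨⟨x, hx⟩, rfl⟩
  haveI : CompactSpace C := isCompact_iff_compactSpace.1 (Subgroup.isClosed_topologicalClosure _).isCompact
  let e : C ≃* Multiplicative ℤ_[p] := MulEquiv.ofBijective κC hκC
  have he : Continuous e := κ.continuous_toFun.comp continuous_subtype_val
  let h : C ≃ₜ Multiplicative ℤ_[p] := Continuous.homeoOfEquivCompactToT2 (f := e.toEquiv) he
  refine ⟨{ toMonoidHom := C.subtype.comp e.symm.toMonoidHom,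
            continuous_toFun := continuous_subtype_val.comp h.symm.continuous }, fun y ↦ ?_⟩
  change κC (e.symm y) = y
  exact e.apply_symm_apply y

end Section

end Literature.GroupTheory

end
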